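import Summits.QuantumAdvantage.QuantumAdvantage.Theorems.CubicForrelationNearExactIsExactAxParity
import Summits.QuantumAdvantage.QuantumAdvantage.Theorems.CubicForrelationNearExactIsExactValueGranularity

/-!
# Crux `CubicForrelation.NearExactIsExact` (stmt-QuantumAdvantage-14043), line `direct-sum-amplification`, lead c6 cycle 2:
  stub `stub_typeE8` — type E is stable under quadratic perturbation of a bent cubic on 8 bits

If `A` is a cubic bent function on `8` bits (`W_A(x)² = 2⁸`) and `B` has degree `≤ 2`, then every Walsh value of `A ⊕ B`
is a multiple of `16` ("type E").  Used by the lead to exclude the BALANCED split case of the `n = 10`, `θ = 7/8` isolation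
(the type-O partner `G[0,1] = A ⊕ D` cannot exist).

Proof (all tools in the tree). The character `(−1)^{x·y}` is the sign of the affine function `ℓ_x(y) = [x·y odd]`
(`vg_W_eq_sum_signOf_bxor`, `knf_isDegLeFun_ip`), so `W_{A⊕B}(x) = Σ_y (−1)^{A ⊕ (B ⊕ ℓ_x)}` with `B ⊕ ℓ_x` still quadratic,
and it suffices to show `Σ_y (−1)^{(A ⊕ q)(y)} ∈ 16ℤ` for every quadratic `q`. Write `q` as the xor of the monomials of a
representing `MvPolynomial` of total degree `≤ 2` (`MvPolynomial.as_sum`, coefficients `1`: `ax_coeff_eq_one`) and induct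
over its support (`te_induct`). The empty sum gives `W_A(0) = ±16` (`bb_eq_or_eq_neg_of_sq_eq`). Adding one monomial
`m = Π_{i ∈ V} y_i` (`|V| ≤ 2`, `ax_card_support_le`) changes the sum by `−2·Σ_{y ∈ F} (−1)^{(A⊕q)(y)}` over the coordinate
flat `F = {y : y_i = 1 ∀ i ∈ V}` (`te_sum_step`), and `Σ_{F} (−1)^{A ⊕ q} ∈ 8ℤ` (`te_flat`): pointwise
`(−1)^{a ⊕ b} = 1 + (−1)^a + (−1)^b − 2(−1)^{a ∧ b}` (`te_signOf_bxor`), `|F| = 2^{8−|V|} ∈ 8ℤ`, and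
* `Σ_F (−1)^A ∈ 8ℤ` (`te_flat_bent`): `F = t ⊕ E_{Vᶜ}` with `t = 1_V` (`te_sum_flat_eq`), Poisson summation over the cube
  `E_V` for the translate `y ↦ (−1)^{A(t ⊕ y)}` (`bb_poisson`), whose Walsh values are `(−1)^{t·u} W_A(u) = ±16·(−1)^{d(u)}`
  with `d` the dual of `A` (`sum_shift_twist`, `bb_exists_dual`): `2^{|V|} Σ_F (−1)^A = 16 (2^{|V|} − 2w)`, `|V| ≤ 2`;
* `Σ_F (−1)^q ∈ 8ℤ` and `Σ_F (−1)^{A ∧ q} ∈ 4ℤ` (`te_flat_ax`): Ax's theorem on the cube `E_{Vᶜ}` (`stub_axParity`, `|Vᶜ| ≥ 6`)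
  for the translates of `q` (degree `≤ 2`, exponent `⌈6/2⌉ = 3`) and of `A ∧ q` (degree `≤ 5`, exponent `⌈6/5⌉ = 2`);
  translation keeps the degree (`knf_isDegLeFun_comp`).
Confirmed numerically by the exhaustive scan kit j022588 (14 EA-classes of cubic bent functions × 2²⁸ quadratics: zero
type-O partners). References: J. Ax, *Zeroes of polynomials over finite fields*, Amer. J. Math. 86 (1964); R. J. McEliece,
*Weight congruences for p-ary cyclic codes*, Discrete Math. 3 (1972); O. S. Rothaus, *On "bent" functions*, JCTA 20 (1976);
C. Carlet, *Boolean Functions for Cryptography and Coding Theory*, CUP 2021, §4.1, §6.1. Everything below is proved from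
Mathlib and the tree; axioms are the standard three. Imports: the landed AxParity file (which brings the Rothaus / bent-duality
lemmas) and the landed ValueGranularity file (the twist-as-affine-sign dictionary); the Theses file is NOT imported.
-/

set_option linter.dupNamespace false -- D-0017: single-problem summit ⇒ `QuantumAdvantage.QuantumAdvantage` by design

noncomputable section

namespace Summit.QuantumAdvantage.QuantumAdvantage.Theorems.CubicForrelation.NearExactIsExact

open Finset
open Literature.Computability.QuantumComplexity
open Literature.Computability.QuantumComplexity.BuzetChailloux (bxor zeroVec signOf_sq bxor_bxor_cancel_left
  twist_zeroVec_right)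
open Literature.Computability.QuantumComplexity.DerivativeWalsh (W sum_shift_twist)
open Summit.QuantumAdvantage.QuantumAdvantage.Theorems.SignedCubicForrelationNotPrBPP (knf_isDegLeFun_ip
  knf_isDegLeFun_comp knf_polyPhase_add')

variable {n : ℕ}

/-! ### Boolean signs and polynomial phases -/

/-- `(−1)^{a ⊕ b} = 1 + (−1)^a + (−1)^b − 2 (−1)^{a ∧ b}`. [folklore] -/
theorem te_signOf_bxor (a b : Bool) : signOf (a ^^ b) = 1 + signOf a + signOf b - 2 * signOf (a && b) := by
  cases a <;> cases b <;> norm_num [signOf]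

/-- `a ⊕ (m ⊕ q) = (a ⊕ q) ⊕ m`. [folklore] -/
theorem te_bool_xor3 : ∀ a m q : Bool, (a ^^ (m ^^ q)) = ((a ^^ q) ^^ m) := by decide

/-- The zero polynomial defines the constant function `0`. [folklore] -/
theorem te_polyPhase_zero (x : Fin n → Bool) : polyPhase (0 : MvPolynomial (Fin n) (ZMod 2)) x = false := by
  rw [polyPhase_apply, map_zero]
  decide

/-- The monomial `X^s` (coefficient `1`) defines the indicator of the coordinate flat `{x : x_i = 1 ∀ i ∈ supp s}`.
[cite: Carlet2020, §2.2.1 eq. (2.1)] -/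
theorem te_polyPhase_monomial (s : Fin n →₀ ℕ) (x : Fin n → Bool) :
    polyPhase (MvPolynomial.monomial s (1 : ZMod 2)) x = decide (∀ i ∈ s.support, x i = true) := by
  rw [polyPhase_apply, ax_eval_pt, MvPolynomial.support_monomial, if_neg (by decide : (1 : ZMod 2) ≠ 0),
    sum_singleton]
  by_cases h : ∀ i ∈ s.support, x i = true
  · rw [if_pos h, decide_eq_true h]
    decide
  · rw [if_neg h, decide_eq_false h]
    decide

/-- Over `𝔽₂` a polynomial is the sum of the monomials in its support (all coefficients are `1`). [folklore] -/
theorem te_sum_monomial_eq (p : MvPolynomial (Fin n) (ZMod 2)) :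
    ∑ s ∈ p.support, MvPolynomial.monomial s (1 : ZMod 2) = p := by
  conv_rhs => rw [p.as_sum]
  exact sum_congr rfl fun s hs => by rw [ax_coeff_eq_one hs]

/-- A partial sum of the monomials of a polynomial of total degree `≤ d` has total degree `≤ d`. [folklore] -/
theorem te_totalDegree_le {d : ℕ} {p : MvPolynomial (Fin n) (ZMod 2)} (hp : p.totalDegree ≤ d)
    {T : Finset (Fin n →₀ ℕ)} (hT : T ⊆ p.support) :
    (∑ s ∈ T, MvPolynomial.monomial s (1 : ZMod 2)).totalDegree ≤ d :=
  MvPolynomial.totalDegree_finsetSum_le fun s hs =>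
    (MvPolynomial.totalDegree_monomial s (by decide : (1 : ZMod 2) ≠ 0)).trans_le
      ((MvPolynomial.le_totalDegree (hT hs)).trans hp)

/-- Degrees add under conjunction (product of representing polynomials). [cite: Carlet2020, §2.2.1 Def. 6] -/
theorem te_isDegLeFun_band {a b : ℕ} {f g : (Fin n → Bool) → Bool} (hf : IsDegLeFun a f) (hg : IsDegLeFun b g) :
    IsDegLeFun (a + b) (fun x => f x && g x) := by
  obtain ⟨p, hp, hpf⟩ := hf
  obtain ⟨q, hq, hqg⟩ := hg
  refine ⟨p * q, (MvPolynomial.totalDegree_mul p q).trans (Nat.add_le_add hp hq), fun x => ?_⟩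
  show (f x && g x) = polyPhase (p * q) x
  rw [hpf, hqg, polyPhase_apply, polyPhase_apply, polyPhase_apply, map_mul]
  generalize MvPolynomial.eval (fun j => if x j then (1 : ZMod 2) else 0) p = u
  generalize MvPolynomial.eval (fun j => if x j then (1 : ZMod 2) else 0) q = v
  revert u v
  decide

/-- Translation keeps the algebraic degree: `x ↦ F(v ⊕ x)` has degree `≤ k` if `F` has (affine substitution
`X_j ↦ v_j + X_j`, `knf_isDegLeFun_comp`). [cite: Carlet2020, §2.2.1 Def. 6] -/
theorem te_isDegLeFun_shift {k : ℕ} {F : (Fin n → Bool) → Bool} (hF : IsDegLeFun k F) (v : Fin n → Bool) :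
    IsDegLeFun k (fun x => F (bxor v x)) :=
  knf_isDegLeFun_comp hF (fun x => bxor v x) fun j =>
    bb_isDegLeFun_bxor (isDegLeFun_const 1 (v j)) (isDegLeFun_apply j le_rfl)

/-! ### Coordinate flats `{y : y_i = 1 ∀ i ∈ V}` as translates of coordinate cubes -/

/-- The coordinate flat `F_V = {y : y_i = 1 ∀ i ∈ V}` is the translate by `t = 1_V` of the cube `E_{Vᶜ} = {x : supp x ⊆ Vᶜ}`:
`Σ_{y ∈ F_V} G(y) = Σ_{x ∈ E_{Vᶜ}} G(t ⊕ x)`. [folklore] -/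
theorem te_sum_flat_eq (G : (Fin n → Bool) → ℝ) (V : Finset (Fin n)) :
    ∑ y ∈ {y : Fin n → Bool | ∀ i ∈ V, y i = true}, G y =
      ∑ x ∈ {u : Fin n → Bool | ∀ i, u i = true → i ∈ Vᶜ}, G (bxor (fun i => decide (i ∈ V)) x) := by
  refine sum_nbij' (bxor (fun i => decide (i ∈ V))) (bxor (fun i => decide (i ∈ V))) ?_ ?_
    (fun y _ => bxor_bxor_cancel_left _ y) (fun x _ => bxor_bxor_cancel_left _ x)
    (fun y _ => by simp only [bxor_bxor_cancel_left])
  · intro y hy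
    simp only [mem_filter, mem_univ, true_and, mem_compl] at hy ⊢
    intro i hi hiV
    have h := hy i hiV
    simp [bxor, hiV, h] at hi
  · intro x hx
    simp only [mem_filter, mem_univ, true_and, mem_compl] at hx ⊢
    intro i hiV
    cases hxi : x i
    · simp [bxor, hiV, hxi]
    · exact absurd hiV (hx i hxi)

/-- `Σ_{u ∈ E_V} (−1)^{h(u)} = 2^{|V|} − 2·#{u ∈ E_V : h u = 1}` (`bb_sum_signOf`, `bb_card_cube`). [folklore] -/
theorem te_cube_sum_signOf (h : (Fin n → Bool) → Bool) (V : Finset (Fin n)) :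
    ∃ w : ℕ, ∑ u ∈ {u : Fin n → Bool | ∀ i, u i = true → i ∈ V}, signOf (h u) = (2 : ℝ) ^ #V - 2 * (w : ℝ) := by
  refine ⟨#{u : Fin n → Bool | (∀ i, u i = true → i ∈ V) ∧ h u = true}, ?_⟩
  rw [bb_sum_signOf, bb_card_cube, Nat.cast_pow, Nat.cast_ofNat]

/-- **Ax on a coordinate flat.** For `h` of degree `≤ d` (`d ≥ 1`) and `c ≤ ⌈|Vᶜ|/d⌉`: `Σ_{y ∈ F_V} (−1)^{h(y)} ∈ 2^c ℤ`
(translate to the cube `E_{Vᶜ}` and apply `stub_axParity` to `x ↦ h(t ⊕ x)`). [cite: Carlet2020, §4.1] -/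
theorem te_flat_ax {d : ℕ} (c : ℕ) (h : (Fin n → Bool) → Bool) (hd : 1 ≤ d) (hh : IsDegLeFun d h)
    (V : Finset (Fin n)) (hc : c ≤ (#Vᶜ + d - 1) / d) :
    ∃ k : ℤ, ∑ y ∈ {y : Fin n → Bool | ∀ i ∈ V, y i = true}, signOf (h y) = (2 : ℝ) ^ c * (k : ℝ) := by
  obtain ⟨z, hz⟩ := stub_axParity n d (fun x => h (bxor (fun i => decide (i ∈ V)) x)) Vᶜ hd
    (te_isDegLeFun_shift hh _)
  obtain ⟨e, he⟩ : ∃ e, (#Vᶜ + d - 1) / d = c + e := ⟨(#Vᶜ + d - 1) / d - c, (Nat.add_sub_of_le hc).symm⟩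
  refine ⟨2 ^ e * z, ?_⟩
  rw [te_sum_flat_eq, hz, he, pow_add]
  push_cast
  ring

/-- **Poisson on a coordinate flat for a bent function on 8 bits.** If `W_A(x)² = 2⁸` for all `x` and `|V| ≤ 2`, then
`Σ_{y ∈ F_V} (−1)^{A(y)} ∈ 8ℤ`: with `t = 1_V` and the dual `d` of `A` (`W_A = 16 (−1)^d`, `bb_exists_dual`), Poisson
summation over `E_V` for `y ↦ (−1)^{A(t ⊕ y)}` (`bb_poisson`; its Walsh values are `(−1)^{t·u} W_A(u)`, `sum_shift_twist`)
gives `2^{|V|} Σ_{F_V} (−1)^A = 16 Σ_{u ∈ E_V} (−1)^{d(u) ⊕ [t·u odd]} = 16 (2^{|V|} − 2w)`. [cite: Carlet2020, §6.1] -/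
theorem te_flat_bent (A : (Fin (4 + 4) → Bool) → Bool)
    (hbent : ∀ x, W (fun y => signOf (A y)) x ^ 2 = (2 : ℝ) ^ (4 + 4)) (V : Finset (Fin (4 + 4)))
    (hV : #V ≤ 2) :
    ∃ k : ℤ, ∑ y ∈ {y : Fin (4 + 4) → Bool | ∀ i ∈ V, y i = true}, signOf (A y) = 8 * (k : ℝ) := by
  obtain ⟨d, hd⟩ := bb_exists_dual hbent
  have hP := bb_poisson (fun y => signOf (A (bxor (fun i => decide (i ∈ V)) y))) V
  rw [← te_sum_flat_eq (fun y => signOf (A y)) V] at hP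
  have hL : ∀ u : Fin (4 + 4) → Bool, W (fun y => signOf (A (bxor (fun i => decide (i ∈ V)) y))) u =
      (2 : ℝ) ^ 4 * signOf (d u ^^ decide (Odd #(univ.filter fun i => u i && decide (i ∈ V)))) := by
    intro u
    rw [signOf_xor, ← vg_twist_eq_signOf, ← mul_assoc, ← hd u, mul_comm, twist_comm]
    exact sum_shift_twist (fun y => signOf (A y)) _ u
  obtain ⟨w, hw⟩ := te_cube_sum_signOf
    (fun u => d u ^^ decide (Odd #(univ.filter fun i => u i && decide (i ∈ V)))) V
  rw [sum_congr rfl fun u _ => hL u, ← mul_sum, hw] at hP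
  obtain ⟨e, he⟩ : ∃ e, #V + e = 2 := ⟨2 - #V, by omega⟩
  have h4 : (2 : ℝ) ^ 2 = 2 ^ #V * 2 ^ e := by rw [← pow_add, he]
  refine ⟨2 - 2 ^ e * (w : ℤ), mul_left_cancel₀ (show (2 : ℝ) ^ #V ≠ 0 by positivity) ?_⟩
  rw [← hP]
  push_cast
  linear_combination (-8 * (w : ℝ)) * h4

/-- **The flat lemma.** For `A` cubic and bent on 8 bits, `q` quadratic and `|V| ≤ 2`: `Σ_{y ∈ F_V} (−1)^{(A ⊕ q)(y)} ∈ 8ℤ`,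
by `te_signOf_bxor` termwise: `|F_V| = 2^{8 − |V|} ∈ 8ℤ`, `Σ_F (−1)^A ∈ 8ℤ` (`te_flat_bent`), `Σ_F (−1)^q ∈ 8ℤ` (Ax, `d = 2`,
`⌈6/2⌉ = 3`) and `Σ_F (−1)^{A ∧ q} ∈ 4ℤ` (Ax, `d = 5`, `⌈6/5⌉ = 2`). [cite: Carlet2020, §4.1] -/
theorem te_flat (A q : (Fin (4 + 4) → Bool) → Bool) (hA : IsDegLeFun 3 A)
    (hbent : ∀ x, W (fun y => signOf (A y)) x ^ 2 = (2 : ℝ) ^ (4 + 4)) (hq : IsDegLeFun 2 q)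
    (V : Finset (Fin (4 + 4))) (hV : #V ≤ 2) :
    ∃ k : ℤ, ∑ y ∈ {y : Fin (4 + 4) → Bool | ∀ i ∈ V, y i = true}, signOf (A y ^^ q y) = 8 * (k : ℝ) := by
  have hVc : 6 ≤ #Vᶜ := by
    rw [card_compl, Fintype.card_fin]
    omega
  obtain ⟨a, ha⟩ := te_flat_bent A hbent V hV
  obtain ⟨b, hb⟩ := te_flat_ax (d := 2) 3 q (by norm_num) hq V (by omega)
  obtain ⟨c, hc⟩ := te_flat_ax (d := 5) 2 (fun y => A y && q y) (by norm_num) (te_isDegLeFun_band hA hq) V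
    (by omega)
  obtain ⟨e, he⟩ : ∃ e, #Vᶜ = e + 3 := ⟨#Vᶜ - 3, by omega⟩
  have hF : ∑ y ∈ {y : Fin (4 + 4) → Bool | ∀ i ∈ V, y i = true}, (1 : ℝ) = 8 * 2 ^ e := by
    rw [te_sum_flat_eq (fun _ => (1 : ℝ)) V, sum_const, bb_card_cube, he, nsmul_eq_mul, mul_one]
    push_cast
    ring
  refine ⟨2 ^ e + a + b - c, ?_⟩
  rw [sum_congr rfl fun y _ => te_signOf_bxor (A y) (q y), sum_sub_distrib, sum_add_distrib, sum_add_distrib,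
    ← mul_sum, hF, ha, hb, hc]
  push_cast
  ring

/-! ### Adding one monomial, and the induction over the support -/

/-- Adding the indicator `m_V` of the flat `F_V` to `c` flips the sign exactly on `F_V`:
`Σ_y (−1)^{c(y) ⊕ m_V(y)} = Σ_y (−1)^{c(y)} − 2 Σ_{y ∈ F_V} (−1)^{c(y)}`. [folklore] -/
theorem te_sum_step (c : (Fin n → Bool) → Bool) (V : Finset (Fin n)) :
    ∑ y, signOf (c y ^^ decide (∀ i ∈ V, y i = true)) =
      ∑ y, signOf (c y) - 2 * ∑ y ∈ {y : Fin n → Bool | ∀ i ∈ V, y i = true}, signOf (c y) := by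
  rw [sum_filter, mul_sum, ← sum_sub_distrib]
  refine sum_congr rfl fun y _ => ?_
  by_cases h : ∀ i ∈ V, y i = true
  · rw [decide_eq_true h, if_pos h]
    cases c y <;> norm_num [signOf]
  · rw [decide_eq_false h, if_neg h]
    cases c y <;> norm_num [signOf]

/-- **The induction over the monomials.** For `A` cubic and bent on 8 bits and `p` of total degree `≤ 2`: for every
`T ⊆ supp p`, `Σ_y (−1)^{A(y) ⊕ q_T(y)} ∈ 16ℤ` where `q_T` is the Boolean function of `Σ_{s ∈ T} X^s`. Base: `W_A(0) = ±16`
(`bb_eq_or_eq_neg_of_sq_eq`); step: `te_sum_step` and the flat lemma `te_flat` (the new monomial has `≤ 2` variables,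
`ax_card_support_le`). [cite: Carlet2020, §4.1] -/
theorem te_induct (A : (Fin (4 + 4) → Bool) → Bool) (hA : IsDegLeFun 3 A)
    (hbent : ∀ x, W (fun y => signOf (A y)) x ^ 2 = (2 : ℝ) ^ (4 + 4))
    {p : MvPolynomial (Fin (4 + 4)) (ZMod 2)} (hp : p.totalDegree ≤ 2)
    (T : Finset (Fin (4 + 4) →₀ ℕ)) (hT : T ⊆ p.support) :
    ∃ k : ℤ, ∑ y, signOf (A y ^^ polyPhase (∑ s ∈ T, MvPolynomial.monomial s (1 : ZMod 2)) y) = 16 * (k : ℝ) := by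
  induction T using Finset.induction_on with
  | empty =>
    rw [sum_empty]
    simp_rw [te_polyPhase_zero, Bool.xor_false]
    have h0 : W (fun y => signOf (A y)) zeroVec = ∑ y, signOf (A y) := by
      unfold W
      exact sum_congr rfl fun y _ => by rw [twist_zeroVec_right, mul_one]
    rcases bb_eq_or_eq_neg_of_sq_eq (hbent zeroVec) with h | h
    · exact ⟨1, by rw [← h0, h]; norm_num⟩
    · exact ⟨-1, by rw [← h0, h]; norm_num⟩
  | insert s T hs ih =>
    obtain ⟨k₁, hk₁⟩ := ih ((subset_insert s T).trans hT)
    have hsp : s ∈ p.support := hT (mem_insert_self s T)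
    have hqT : IsDegLeFun 2 (polyPhase (∑ s ∈ T, MvPolynomial.monomial s (1 : ZMod 2))) :=
      isDegLeFun_polyPhase (te_totalDegree_le hp ((subset_insert s T).trans hT))
    obtain ⟨k₂, hk₂⟩ := te_flat A _ hA hbent hqT s.support (ax_card_support_le hp hsp)
    refine ⟨k₁ - k₂, ?_⟩
    rw [sum_insert hs]
    simp_rw [knf_polyPhase_add', te_polyPhase_monomial, te_bool_xor3]
    rw [te_sum_step, hk₁, hk₂]
    push_cast
    ring

/-! ### The stub -/

/-- **Type E is stable under quadratic perturbation of a bent cubic on 8 bits.**  If `A : 𝔽₂⁸ → 𝔽₂` is cubic and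
bent and `B` has degree `≤ 2`, every Walsh value of `A ⊕ B` is divisible by `16`: absorb the character `(−1)^{x·y}` into
`B` (`vg_W_eq_sum_signOf_bxor`, `knf_isDegLeFun_ip`: `B ⊕ ℓ_x` is quadratic), write the quadratic as the xor of its monomials
(`te_sum_monomial_eq`) and apply `te_induct` with `T = supp p`. [folklore 2-adic analysis: Ax 1964 / McEliece 1972
divisibility + Poisson summation + Rothaus duality; this combination appears to be new] -/
theorem stub_typeE8 :
    ∀ (A B : (Fin (4 + 4) → Bool) → Bool), IsDegLeFun 3 A → IsDegLeFun 2 B →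
      (∀ x, W (fun y => signOf (A y)) x ^ 2 = (2 : ℝ) ^ (4 + 4)) →
      ∀ x, ∃ k : ℤ, W (fun y => signOf (A y ^^ B y)) x = 16 * (k : ℝ) := by
  intro A B hA hB hbent x
  obtain ⟨p, hp, hrep⟩ := bb_isDegLeFun_bxor hB ((knf_isDegLeFun_ip x).mono (by norm_num : 1 ≤ 2))
  obtain ⟨k, hk⟩ := te_induct A hA hbent hp p.support Subset.rfl
  refine ⟨k, ?_⟩
  rw [← hk, vg_W_eq_sum_signOf_bxor]
  refine sum_congr rfl fun y _ => ?_
  rw [Bool.xor_assoc, te_sum_monomial_eq p, ← hrep y]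

end Summit.QuantumAdvantage.QuantumAdvantage.Theorems.CubicForrelation.NearExactIsExact
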